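import Literature.RepresentationTheory.HeisenbergGroup.LatticeModel
import HarnessLib

/-!
# The lattice model is irreducible (jointly with an irreducible coefficient representation)

Topic `RepresentationTheory/HeisenbergGroup`; namespace `Literature.RepresentationTheory.HeisenbergGroup.LatticeModel`.
KERNEL ONLY: theorems; no definition, no named fact, no `sorry`.

Continuation of `LatticeModel.lean`.  For `H = Heisenberg (polar β)`, `A = B₁ × B₂ × R` with `(B₁, B₂)` in
DUALITY for `ψ ∘ β` (`ψ(β(B₁, B₂)) = 1`, `B₁ = ^⊥B₂`, `B₂ = B₁^⊥` — the algebraic content of a dual lattice pair), the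
lattice model `rep = Ind_A^H ψ_A` on `ℓ²(A\H; E)`, together with the coefficient representation `coeff π` of a group
`G` acting on `E` by isometries WITH SCALAR COMMUTANT, is JOINTLY IRREDUCIBLE: a closed subspace invariant under all
`rep h` and all `coeff g` is `⊥` or `⊤` (**`irreducible`**).  For `E = ℂ`, `G` trivial this is the irreducibility of
the lattice model (MVW, Chap. 2, I.3, II.8; Weil 1964 n° 12–13), i.e. the EXISTENCE of an irreducible unitary
`ψ`-representation of `H` on a Hilbert space; with `E` the archimedean Schrödinger model it is the joint
irreducibility needed for the adelic `ρ_ψ` of [GelbartRogawski1991, §3.1 p. 454 L19–21].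

Proof (Mackey's criterion made elementary, `A` being normal with `H/A` discrete abelian): the orthogonal projection
`P` onto an invariant closed subspace commutes with the action (`starProjection_map_of_invariant`); `A` acts on the
`q`-th coordinate through the character `χ_q(a) = phase((sec q, 0) · a)` and distinct cosets have distinct characters
(`exists_phase_ne`, by duality), so `P` is diagonal (`starProjection_single_apply_of_ne`); its diagonal entries
commute with `π`, hence are scalars `c_q` (hypothesis `hπ'`), and `H` permutes the cosets transitively, so `c_q = c`
(`rep_single`); thus `P = c · 1`, and `K = ⊥` or `⊤`.

## References
* [MoeglinVignerasWaldspurger1987] C. Mœglin, M.-F. Vignéras, J.-L. Waldspurger, LNM 1291 (1987), Chap. 2, I.3, II.8.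
* [Weil1964] A. Weil, Acta Math. 111 (1964), Chap. I n° 12–13.
* [GelbartRogawski1991] S. Gelbart, J. Rogawski, Invent. Math. 105 (1991), §3.1 p. 454 L19–21.
-/

set_option autoImplicit false

noncomputable section

open scoped ENNReal InnerProductSpace

namespace Literature.RepresentationTheory.HeisenbergGroup

namespace LatticeModel

variable {Rf : Type*} [CommRing Rf] {Xf Yf : Type*} [AddCommGroup Xf] [Module Rf Xf] [AddCommGroup Yf] [Module Rf Yf]
  (β : Xf →ₗ[Rf] Yf →ₗ[Rf] Rf) (ψ : AddChar Rf Circle) (B₁ : AddSubgroup Xf) (B₂ : AddSubgroup Yf)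
  (E : Type*) [NormedAddCommGroup E] [InnerProductSpace ℂ E]
  (hψ : ∀ x ∈ B₁, ∀ y ∈ B₂, ψ (β x y) = 1)

/-! ## §1 The eigencharacters of `A` on the coordinates -/

/-- the phase of `(sec q, 0) · (b, t)` for `b ∈ B₁ × B₂`: `ψ(t + β (sec q)₁ b₂ − β b₁ (sec q)₂)` — the character `χ_q`
of `A` on the `q`-th coordinate. [cite: MoeglinVignerasWaldspurger1987, Chap. 2 I.3] -/
theorem phase_sec_mul (q : (Xf × Yf) ⧸ B₁.prod B₂) {b : Xf × Yf} (hb : b ∈ B₁.prod B₂) (t : Rf) :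
    phase β ψ B₁ B₂ (⟨sec B₁ B₂ q, 0⟩ * ⟨b, t⟩) = ψ (t + β (sec B₁ B₂ q).1 b.2 - β b.1 (sec B₁ B₂ q).2) := by
  have hq : (QuotientAddGroup.mk (sec B₁ B₂ q + b) : (Xf × Yf) ⧸ B₁.prod B₂) = q := by
    rw [QuotientAddGroup.mk_add, mk_sec, (QuotientAddGroup.eq_zero_iff b).2 hb, add_zero]
  unfold phase
  simp only [Heisenberg.mul_v, Heisenberg.mul_t, polar_apply, hq, zero_add, add_sub_cancel_left]

/-- an element of `A` acts on `ℓ²(A\\H; E)` DIAGONALLY: `(rep a F) q = χ_q(a) • F q`.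
[cite: MoeglinVignerasWaldspurger1987, Chap. 2 I.3] -/
theorem rep_apply_of_mem (a : Heisenberg (polar β)) (ha : a.v ∈ B₁.prod B₂)
    (F : lp (fun _ : (Xf × Yf) ⧸ B₁.prod B₂ => E) 2) (q : (Xf × Yf) ⧸ B₁.prod B₂) :
    rep β ψ B₁ B₂ E hψ a F q = ((phase β ψ B₁ B₂ (⟨sec B₁ B₂ q, 0⟩ * a) : ℂ)) • F q := by
  rw [rep_apply, (QuotientAddGroup.eq_zero_iff a.v).2 ha, add_zero]

/-- **distinct cosets have distinct eigencharacters** (duality `B₁ = ^⊥B₂`, `B₂ = B₁^⊥`): for `q ≠ p` some `a ∈ A` has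
`χ_q(a) ≠ χ_p(a)`. [cite: MoeglinVignerasWaldspurger1987, Chap. 2 I.3] -/
theorem exists_phase_ne (h₁ : ∀ x : Xf, x ∉ B₁ → ∃ y ∈ B₂, ψ (β x y) ≠ 1)
    (h₂ : ∀ y : Yf, y ∉ B₂ → ∃ x ∈ B₁, ψ (β x y) ≠ 1) {q p : (Xf × Yf) ⧸ B₁.prod B₂} (hqp : q ≠ p) :
    ∃ a : Heisenberg (polar β), a.v ∈ B₁.prod B₂ ∧
      phase β ψ B₁ B₂ (⟨sec B₁ B₂ q, 0⟩ * a) ≠ phase β ψ B₁ B₂ (⟨sec B₁ B₂ p, 0⟩ * a) := by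
  have hd : sec B₁ B₂ q - sec B₁ B₂ p ∉ B₁.prod B₂ := by
    intro hmem
    apply hqp
    rw [← mk_sec B₁ B₂ q, ← mk_sec B₁ B₂ p, QuotientAddGroup.eq]
    have : -sec B₁ B₂ q + sec B₁ B₂ p = -(sec B₁ B₂ q - sec B₁ B₂ p) := by abel
    rw [this]
    exact neg_mem hmem
  rw [AddSubgroup.mem_prod, not_and_or] at hd
  rcases hd with hx | hy
  · obtain ⟨y, hy, hne⟩ := h₁ _ hx
    refine ⟨⟨(0, y), 0⟩, ⟨zero_mem _, hy⟩, fun heq => hne ?_⟩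
    rw [phase_sec_mul β ψ B₁ B₂ q ⟨zero_mem _, hy⟩, phase_sec_mul β ψ B₁ B₂ p ⟨zero_mem _, hy⟩] at heq
    simp only [map_zero, LinearMap.zero_apply, sub_zero, zero_add] at heq
    rw [Prod.fst_sub, map_sub, LinearMap.sub_apply, AddChar.map_sub_eq_div, heq, div_self']
  · obtain ⟨x, hx, hne⟩ := h₂ _ hy
    refine ⟨⟨(x, 0), 0⟩, ⟨hx, zero_mem _⟩, fun heq => hne ?_⟩
    rw [phase_sec_mul β ψ B₁ B₂ q ⟨hx, zero_mem _⟩, phase_sec_mul β ψ B₁ B₂ p ⟨hx, zero_mem _⟩] at heq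
    simp only [map_zero, zero_add, zero_sub] at heq
    rw [Prod.snd_sub, map_sub, AddChar.map_sub_eq_div, div_eq_one]
    have := congrArg (fun c : Circle => c⁻¹) heq
    simpa only [AddChar.map_neg_eq_inv, inv_inv] using this

/-! ## §2 The action on the basis vectors `δ_q ⊗ v` -/

/-- `A` on a basis vector: `rep a (δ_q v) = χ_q(a) • δ_q v`. [cite: MoeglinVignerasWaldspurger1987, Chap. 2 I.3] -/
theorem rep_single_of_mem [DecidableEq ((Xf × Yf) ⧸ B₁.prod B₂)] (a : Heisenberg (polar β))
    (ha : a.v ∈ B₁.prod B₂) (q : (Xf × Yf) ⧸ B₁.prod B₂) (v : E) :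
    rep β ψ B₁ B₂ E hψ a (lp.single 2 q v) =
      ((phase β ψ B₁ B₂ (⟨sec B₁ B₂ q, 0⟩ * a) : ℂ)) • lp.single 2 q v := by
  apply lp.ext
  funext p
  rw [rep_apply_of_mem β ψ B₁ B₂ E hψ a ha, lp.coeFn_smul, Pi.smul_apply, lp.single_apply]
  by_cases hpq : p = q
  · subst hpq
    rfl
  · rw [Pi.single_eq_of_ne hpq, smul_zero, smul_zero]

/-- `H` on a basis vector: `rep h (δ_q v) = phase((sec (q − [h.v]), 0) · h) • δ_{q − [h.v]} v` — `H` permutes the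
cosets (transitively). [cite: MoeglinVignerasWaldspurger1987, Chap. 2 I.3] -/
theorem rep_single [DecidableEq ((Xf × Yf) ⧸ B₁.prod B₂)] (w : Xf × Yf) (t : Rf)
    (q : (Xf × Yf) ⧸ B₁.prod B₂) (v : E) :
    rep β ψ B₁ B₂ E hψ ⟨w, t⟩ (lp.single 2 q v) =
      ((phase β ψ B₁ B₂ (⟨sec B₁ B₂ (q - QuotientAddGroup.mk w), 0⟩ * ⟨w, t⟩) : ℂ)) •
        lp.single 2 (q - QuotientAddGroup.mk w) v := by
  apply lp.ext
  funext p
  rw [rep_apply, lp.coeFn_smul, Pi.smul_apply, lp.single_apply, lp.single_apply]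
  change ((phase β ψ B₁ B₂ (⟨sec B₁ B₂ p, 0⟩ * ⟨w, t⟩) : ℂ)) •
      (Pi.single q v : (Xf × Yf) ⧸ B₁.prod B₂ → E) (p + QuotientAddGroup.mk w) = _
  by_cases hp : p = q - QuotientAddGroup.mk w
  · subst hp
    rw [sub_add_cancel, Pi.single_eq_same, Pi.single_eq_same]
  · have hp' : p + QuotientAddGroup.mk w ≠ q := fun h' => hp (by rw [← h', add_sub_cancel_right])
    rw [Pi.single_eq_of_ne hp', Pi.single_eq_of_ne hp, smul_zero, smul_zero]

section Coeff

variable {G : Type*} [Group G] (π : Representation ℂ G E) (hπ : ∀ (g : G) (v : E), ‖π g v‖ = ‖v‖)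

/-- the coefficient action on a basis vector: `coeff g (δ_q v) = δ_q (π g v)`.
[cite: GelbartRogawski1991, §3.1 p. 454 L19–21] -/
theorem coeff_single [DecidableEq ((Xf × Yf) ⧸ B₁.prod B₂)] (g : G) (q : (Xf × Yf) ⧸ B₁.prod B₂) (v : E) :
    coeff B₁ B₂ E π hπ g (lp.single 2 q v) = lp.single 2 q (π g v) := by
  apply lp.ext
  funext p
  rw [coeff_apply, lp.single_apply, lp.single_apply]
  by_cases hpq : p = q
  · subst hpq
    rw [Pi.single_eq_same, Pi.single_eq_same]
  · rw [Pi.single_eq_of_ne hpq, Pi.single_eq_of_ne hpq, map_zero]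

end Coeff

/-! ## §3 Orthogonal projections onto invariant subspaces commute with the action -/

/-- **an orthogonal projection onto a subspace invariant under an invertible isometry and its inverse commutes with
it** (the complement is then invariant too). [cite: MoeglinVignerasWaldspurger1987, Chap. 2 II.1 (B)] -/
theorem starProjection_map_of_invariant {V : Type*} [NormedAddCommGroup V] [InnerProductSpace ℂ V]
    (K : Submodule ℂ V) [K.HasOrthogonalProjection] (U : V →ₗᵢ[ℂ] V) (U' : V → V) (hU' : ∀ v, U (U' v) = v)
    (hK : ∀ v ∈ K, U v ∈ K) (hK' : ∀ v ∈ K, U' v ∈ K) (v : V) :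
    K.starProjection (U v) = U (K.starProjection v) := by
  apply Submodule.eq_starProjection_of_mem_of_inner_eq_zero (hK _ (Submodule.starProjection_apply_mem K v))
  intro w hw
  rw [← map_sub, ← hU' w, U.inner_map_map]
  exact Submodule.starProjection_inner_eq_zero v (U' w) (hK' w hw)

/-! ## §4 Joint irreducibility -/

section Irreducible

variable [CompleteSpace E] {G : Type*} [Group G] (π : Representation ℂ G E)
  (hπ : ∀ (g : G) (v : E), ‖π g v‖ = ‖v‖)

/-- **the lattice model with coefficients is jointly irreducible.**  Hypotheses: `ψ(β(B₁, B₂)) = 1` and the duality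
separations `B₁ = ^⊥B₂`, `B₂ = B₁^⊥` (`h₁`, `h₂`); `π` a representation of `G` on the complete coefficient space `E` by
isometries whose COMMUTANT IS SCALAR (`hπ'`: every bounded operator commuting with all `π g` is a scalar).  Then a
closed subspace of `ℓ²(A\\H; E)` invariant under all `rep h` (`h ∈ H`) and all `coeff g` (`g ∈ G`) is `⊥` or `⊤`.
For `E = ℂ`, `G = 1`: the lattice model `Ind_A^H ψ_A` is irreducible. [cite: MoeglinVignerasWaldspurger1987, Chap. 2 I.3, II.8] -/
theorem irreducible (h₁ : ∀ x : Xf, x ∉ B₁ → ∃ y ∈ B₂, ψ (β x y) ≠ 1)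
    (h₂ : ∀ y : Yf, y ∉ B₂ → ∃ x ∈ B₁, ψ (β x y) ≠ 1)
    (hπ' : ∀ T : E →L[ℂ] E, (∀ (g : G) (v : E), T (π g v) = π g (T v)) → ∃ c : ℂ, ∀ v, T v = c • v)
    (K : Submodule ℂ (lp (fun _ : (Xf × Yf) ⧸ B₁.prod B₂ => E) 2))
    (hKc : IsClosed (K : Set (lp (fun _ : (Xf × Yf) ⧸ B₁.prod B₂ => E) 2)))
    (hK₁ : ∀ (h : Heisenberg (polar β)), ∀ F ∈ K, rep β ψ B₁ B₂ E hψ h F ∈ K)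
    (hK₂ : ∀ (g : G), ∀ F ∈ K, coeff B₁ B₂ E π hπ g F ∈ K) : K = ⊥ ∨ K = ⊤ := by
  classical
  haveI : CompleteSpace K := hKc.completeSpace_coe
  set P := K.starProjection with hP
  -- the isometries as linear isometries, and (1) `P` commutes with them
  have hPrep : ∀ (h : Heisenberg (polar β)) (F : lp (fun _ : (Xf × Yf) ⧸ B₁.prod B₂ => E) 2),
      P (rep β ψ B₁ B₂ E hψ h F) = rep β ψ B₁ B₂ E hψ h (P F) := fun h F =>
    starProjection_map_of_invariant K
      { toLinearMap := rep β ψ B₁ B₂ E hψ h, norm_map' := norm_rep_apply β ψ B₁ B₂ E hψ h }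
      (fun F => rep β ψ B₁ B₂ E hψ h⁻¹ F)
      (fun F => by
        change rep β ψ B₁ B₂ E hψ h (rep β ψ B₁ B₂ E hψ h⁻¹ F) = F
        rw [← Module.End.mul_apply, ← map_mul, mul_inv_cancel, map_one, Module.End.one_apply])
      (hK₁ h) (hK₁ h⁻¹) F
  have hPcoeff : ∀ (g : G) (F : lp (fun _ : (Xf × Yf) ⧸ B₁.prod B₂ => E) 2),
      P (coeff B₁ B₂ E π hπ g F) = coeff B₁ B₂ E π hπ g (P F) := fun g F =>
    starProjection_map_of_invariant K
      { toLinearMap := coeff B₁ B₂ E π hπ g, norm_map' := norm_coeff_apply B₁ B₂ E π hπ g }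
      (fun F => coeff B₁ B₂ E π hπ g⁻¹ F)
      (fun F => by
        change coeff B₁ B₂ E π hπ g (coeff B₁ B₂ E π hπ g⁻¹ F) = F
        rw [← Module.End.mul_apply, ← map_mul, mul_inv_cancel, map_one, Module.End.one_apply])
      (hK₂ g) (hK₂ g⁻¹) F
  -- (2) `P` is diagonal: `P (δ_q v)` is supported at `q`
  have hdiag : ∀ (q p : (Xf × Yf) ⧸ B₁.prod B₂) (v : E), p ≠ q → P (lp.single 2 q v) p = 0 := by
    intro q p v hpq
    obtain ⟨a, ha, hne⟩ := exists_phase_ne β ψ B₁ B₂ h₁ h₂ (Ne.symm hpq)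
    have h1 := hPrep a (lp.single 2 q v)
    rw [rep_single_of_mem β ψ B₁ B₂ E hψ a ha, map_smul] at h1
    have h2 := congrArg (fun F : lp (fun _ : (Xf × Yf) ⧸ B₁.prod B₂ => E) 2 => F p) h1
    simp only [lp.coeFn_smul, Pi.smul_apply, rep_apply_of_mem β ψ B₁ B₂ E hψ a ha] at h2
    rw [← sub_eq_zero, ← sub_smul, smul_eq_zero, sub_eq_zero] at h2
    rcases h2 with h2 | h2
    · exact absurd (Circle.coe_inj.1 h2) hne
    · exact h2
  -- the trivial coefficient space
  rcases subsingleton_or_nontrivial E with hE | hE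
  · exact Or.inl ((Submodule.eq_bot_iff K).2 fun F _ => lp.ext (funext fun q => Subsingleton.elim _ _))
  -- (3) the diagonal entries `T q : E →L[ℂ] E`, `T q v = (P (δ_q v)) q`, commute with `π`, hence are scalars `c q`
  have h2 : (2 : ℝ≥0∞) ≠ 0 := by norm_num
  let ev : (Xf × Yf) ⧸ B₁.prod B₂ → (lp (fun _ : (Xf × Yf) ⧸ B₁.prod B₂ => E) 2 →L[ℂ] E) := fun q =>
    LinearMap.mkContinuous
      { toFun := fun F => F q
        map_add' := fun F F' => by simp only [lp.coeFn_add, Pi.add_apply]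
        map_smul' := fun a F => by simp only [lp.coeFn_smul, Pi.smul_apply, RingHom.id_apply] }
      1 fun F => by
        rw [one_mul]
        exact lp.norm_apply_le_norm h2 F q
  have hev : ∀ q (F : lp (fun _ : (Xf × Yf) ⧸ B₁.prod B₂ => E) 2), ev q F = F q := fun q F => rfl
  let T : (Xf × Yf) ⧸ B₁.prod B₂ → (E →L[ℂ] E) := fun q =>
    (ev q).comp (P.comp (lp.singleContinuousLinearMap (𝕜 := ℂ) (E := fun _ : (Xf × Yf) ⧸ B₁.prod B₂ => E)
      (p := 2) q))
  have hT : ∀ q v, T q v = P (lp.single 2 q v) q := fun q v => rfl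
  have hPsingle : ∀ q v, P (lp.single 2 q v) = lp.single 2 q (T q v) := by
    intro q v
    apply lp.ext
    funext p
    by_cases hpq : p = q
    · subst hpq
      rw [hT, lp.single_apply, Pi.single_eq_same]
    · rw [hdiag q p v hpq, lp.single_apply, Pi.single_eq_of_ne hpq]
  have hTπ : ∀ q (g : G) (v : E), T q (π g v) = π g (T q v) := by
    intro q g v
    rw [hT, hT, ← coeff_single B₁ B₂ E π hπ, hPcoeff, coeff_apply]
  choose c hc using fun q => hπ' (T q) (hTπ q)
  have hPsingle' : ∀ q v, P (lp.single 2 q v) = c q • lp.single 2 q v := fun q v => by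
    rw [hPsingle, hc, lp.single_smul]
  -- (4) `H` permutes the cosets transitively, so `c q = c 0`
  obtain ⟨v₀, hv₀⟩ := exists_ne (0 : E)
  have hsingle : ∀ q : (Xf × Yf) ⧸ B₁.prod B₂,
      (lp.single 2 q v₀ : lp (fun _ : (Xf × Yf) ⧸ B₁.prod B₂ => E) 2) ≠ 0 := fun q h0 => hv₀ (by
    have := congrArg (fun F : lp (fun _ : (Xf × Yf) ⧸ B₁.prod B₂ => E) 2 => F q) h0
    simpa only [lp.single_apply, Pi.single_eq_same, lp.coeFn_zero, Pi.zero_apply] using this)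
  have hc0 : ∀ q, c q = c 0 := by
    intro q
    have hq : (0 : (Xf × Yf) ⧸ B₁.prod B₂) - QuotientAddGroup.mk (-sec B₁ B₂ q) = q := by
      rw [QuotientAddGroup.mk_neg, sub_neg_eq_add, zero_add, mk_sec]
    have h1 := hPrep ⟨-sec B₁ B₂ q, 0⟩ (lp.single 2 0 v₀)
    rw [hPsingle' 0 v₀, map_smul, rep_single β ψ B₁ B₂ E hψ, hq, map_smul, hPsingle', smul_comm (c 0)] at h1
    exact smul_left_injective ℂ (hsingle q) (smul_right_injective _ (Circle.coe_ne_zero _) h1)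
  -- (5) `P = c 0 • 1`
  have hPF : ∀ F : lp (fun _ : (Xf × Yf) ⧸ B₁.prod B₂ => E) 2, P F = c 0 • F := by
    intro F
    have hs := lp.hasSum_single (E := fun _ : (Xf × Yf) ⧸ B₁.prod B₂ => E) (p := 2) ENNReal.ofNat_ne_top F
    have h1 : HasSum (fun q => P (lp.single 2 q (F q))) (P F) := P.hasSum hs
    have h3 : (fun q => P (lp.single 2 q (F q))) = fun q => c 0 • lp.single 2 q (F q) := by
      funext q
      rw [hPsingle', hc0]
    rw [h3] at h1
    exact h1.unique (hs.const_smul (c 0))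
  -- (6) conclusion
  by_cases hK : K = ⊥
  · exact Or.inl hK
  · right
    obtain ⟨F₀, hF₀K, hF₀⟩ := (Submodule.ne_bot_iff K).1 hK
    have hc1 : c 0 = 1 := by
      have h1 : P F₀ = F₀ := (Submodule.starProjection_eq_self_iff).2 hF₀K
      rw [hPF] at h1
      have h2 : c 0 • F₀ = (1 : ℂ) • F₀ := by rw [h1, one_smul]
      exact smul_left_injective ℂ hF₀ h2
    rw [eq_top_iff]
    intro F _
    have hF : P F = F := by rw [hPF, hc1, one_smul]
    rw [← hF]
    exact Submodule.starProjection_apply_mem K F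

end Irreducible

end LatticeModel

end Literature.RepresentationTheory.HeisenbergGroup

end
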